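import Summits.QuantumFields.YangMills.Theorems.BalabanLadderIRAbstractBasinRung6
import HarnessLib

/-!
# The abstract purity basin from `1/24`: one QUADRUPLING with the extension at time `3t` (Hölder bookkeeping)

HONEST FRAMING.  Nothing here proves the Yang–Mills mass gap (Clay), a lattice gap, the crux `BalabanLadder.IR` (stmt-QuantumFields-19354) or its
seed; `R4` closes only the conditional finite-𝕋⁴ rung `BalabanLadder.UV`.  Sorry-free POSITIVE GLUE over tree names (helper for item 19354, line
`basin-transfer` of ideator ym-ir-idea-9; RULING director-ym g9-№2): model-free reflection-positivity bookkeeping valid for every compact gauge group at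
every `β ≥ 0`; no volume bounds used.  All Yang–Mills content stays in the hypotheses `ColdExitAt (1/24)`, `AFToColdPressure`, `IRnsc`.

CONTENT.  (§1) Two Hölder-type additions to the one-box spectral API of `HasSpectralDatum` (unit-atom bookkeeping, same pattern as the tree's
`exc_two_mul_le_sq`): `exc_add_le_mul : x_{a+b} ≤ x_a · x_b` and `exc_add_le_of_pow_le : x_{(n+1)a} ≤ c^{n+1} ⇒ x_{a+b} ≤ c · x_b` (every non-top atom has
`rᵢ^a ≤ c`), plus the refined purity bound `exc_le_refined : x_t ≤ δ (1 + δ(1+2δ)²/2)²/2`.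
(§2) The scale jump `L → 4L` done as: cube forward in time `t → 3t` (`x_{3t} ≤ x_t³`, free), sharp cube extension at time `c = 3t` (ratio `4L/(L−3t) ≤ 16`,
factor `4096`, ym-ir-idea-13's `cube_extension_sharp`), then forward `3t → 4t` on the big cube by the root bound (`x'_{4t} ≤ (x'_{3t})^{1/3}·x'_{3t}`, typed
root-free): `boxDefect Z (4L) ≤ 10600 u⁴` for `boxDefect Z L ≤ u ≤ 1/24` — the optimum of the squaring/extension bookkeeping family (entry `≈ 1/22`;
exact doubling enters only at `≈ 1/39`, `abstractBasin_two_pow_6`).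
* `abstractBasin_24 : AbstractBasin (1/24) (1/2^6)` (two quadruplings), `abstractBasin_24_epsStar`;
* `IR_of_exitAt24 : ColdExitAt (1/24) → AFToColdPressure → IRnsc → BalabanLadder.IR` — the bill's seed at ONE tolerance `1/24 ≈ 4.2 %` at ONE cold `4:1`
  torus per β (SU(2), β_W = 2.4, glueball-gas synthesis / idea-7 calibration atlas: side `≈ 35a`).
CEILING (honest): this bookkeeping family cannot enter above `≈ 1/20` (optimising the extension time); `AbstractBasin θ₀ _` is false for `θ₀ ≥ 1/2`; the line's
open abstract stub stays `AbstractBasin (1/8) (1/64)` (idea «modular-moment»).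

Sources: tree `AspectBootstrap.exists_ratios`, `exc_two_mul_le_sq`, `cube_extension_sharp`, `defect_facts`, `exc_eq_exp_Yfun`, `Yfun_le_exc`, `exc_antitone`,
`BasinRung.exc_le_sharp`, `abstractBasin_two_pow_6_epsStar`, `IR_of_exitAt6`; Mathlib `Real.abs_exp_sub_one_sub_id_le`, `pow_le_pow_iff_left₀`.
-/

set_option autoImplicit false

noncomputable section

open MeasureTheory Filter Topology
open Literature.MathematicalPhysics.QuantumFieldTheory Literature.MathematicalPhysics.QuantumLattice
open Summit.QuantumFields.YangMills.Cruxes.IR.ColdPressurePincer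
open Summit.QuantumFields.YangMills.Cruxes.IR.ColdPurityBridge
open Summit.QuantumFields.YangMills.Cruxes.IR.AspectBootstrap

namespace Summit.QuantumFields.YangMills.Cruxes.IR.BasinRung

/-! ## §1 One-box spectral API: Hölder-type monotonicity -/

section OneBox
variable {z : ℕ → ℝ}

/-- `x_{(m+2)+(j+2)} ≤ x_{m+2} · x_{j+2}` (each non-top atom has `rᵢ^{m+2} ≤ x_{m+2}`). -/
theorem exc_add_le_mul (h : HasSpectralDatum z) (m j : ℕ) :
    exc z (m + 2 + (j + 2)) ≤ exc z (m + 2) * exc z (j + 2) := by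
  obtain ⟨ι, _, r, i₀, hr, -, -, -, hx⟩ := exists_ratios h
  have hxm := hx m
  have hxs : HasSum (Function.update (fun i => r i ^ (m + 2 + (j + 2))) i₀ 0) (exc z (m + 2 + (j + 2))) := by
    have := hx (m + j + 2)
    rwa [show m + j + 2 + 2 = m + 2 + (j + 2) from by ring] at this
  have hg0 : ∀ i, 0 ≤ Function.update (fun i => r i ^ (m + 2)) i₀ 0 i := fun i => by
    rcases eq_or_ne i i₀ with rfl | hne
    · simp
    · rw [Function.update_of_ne hne]; exact pow_nonneg (hr i).1 _
  have hterm : ∀ i, i ≠ i₀ → r i ^ (m + 2) ≤ exc z (m + 2) := fun i hne => by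
    have := le_hasSum hxm i fun j _ => hg0 j
    rwa [Function.update_of_ne hne] at this
  have hcmp : ∀ i, Function.update (fun i => r i ^ (m + 2 + (j + 2))) i₀ 0 i ≤
      exc z (m + 2) * Function.update (fun i => r i ^ (j + 2)) i₀ 0 i := fun i => by
    rcases eq_or_ne i i₀ with rfl | hne
    · simp
    · rw [Function.update_of_ne hne, Function.update_of_ne hne, pow_add]
      exact mul_le_mul_of_nonneg_right (hterm i hne) (pow_nonneg (hr i).1 _)
  exact hasSum_le hcmp hxs ((hx j).mul_left (exc z (m + 2)))

/-- Root bound, typed root-free: if `x_{(n+1)(m+2)} ≤ c^{n+1}` (`c ≥ 0`) then every non-top atom has `rᵢ^{m+2} ≤ c`, hence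
`x_{(m+2)+(j+2)} ≤ c · x_{j+2}`. -/
theorem exc_add_le_of_pow_le (h : HasSpectralDatum z) (m j n i : ℕ) (hi : i + 2 = (n + 1) * (m + 2))
    {c : ℝ} (hc : 0 ≤ c) (hle : exc z (i + 2) ≤ c ^ (n + 1)) :
    exc z (m + 2 + (j + 2)) ≤ c * exc z (j + 2) := by
  obtain ⟨ι, _, r, i₀, hr, -, -, -, hx⟩ := exists_ratios h
  have hxi := hx i
  have hg0 : ∀ idx, 0 ≤ Function.update (fun idx => r idx ^ (i + 2)) i₀ 0 idx := fun idx => by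
    rcases eq_or_ne idx i₀ with rfl | hne
    · simp
    · rw [Function.update_of_ne hne]; exact pow_nonneg (hr idx).1 _
  have hterm : ∀ idx, idx ≠ i₀ → r idx ^ (m + 2) ≤ c := fun idx hne => by
    have h1 : r idx ^ (i + 2) ≤ exc z (i + 2) := by
      have := le_hasSum hxi idx fun j _ => hg0 j
      rwa [Function.update_of_ne hne] at this
    have h2 : (r idx ^ (m + 2)) ^ (n + 1) ≤ c ^ (n + 1) := by
      rw [← pow_mul, show (m + 2) * (n + 1) = i + 2 by rw [hi]; ring]
      exact h1.trans hle
    exact (pow_le_pow_iff_left₀ (pow_nonneg (hr idx).1 _) hc (by omega)).1 h2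
  have hxs : HasSum (Function.update (fun idx => r idx ^ (m + 2 + (j + 2))) i₀ 0) (exc z (m + 2 + (j + 2))) := by
    have := hx (m + j + 2)
    rwa [show m + j + 2 + 2 = m + 2 + (j + 2) from by ring] at this
  have hcmp : ∀ idx, Function.update (fun idx => r idx ^ (m + 2 + (j + 2))) i₀ 0 idx ≤
      c * Function.update (fun idx => r idx ^ (j + 2)) i₀ 0 idx := fun idx => by
    rcases eq_or_ne idx i₀ with rfl | hne
    · simp
    · rw [Function.update_of_ne hne, Function.update_of_ne hne, pow_add]
      exact mul_le_mul_of_nonneg_right (hterm idx hne) (pow_nonneg (hr idx).1 _)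
  exact hasSum_le hcmp hxs ((hx j).mul_left c)

/-- `x_{3(m+2)} ≤ x_{m+2}³`. -/
theorem exc_three_mul_le_cube (h : HasSpectralDatum z) (m : ℕ) : exc z (3 * m + 4 + 2) ≤ exc z (m + 2) ^ 3 := by
  have h1 : exc z (m + 2 + (2 * m + 2 + 2)) ≤ exc z (m + 2) * exc z (2 * m + 2 + 2) := exc_add_le_mul h m (2 * m + 2)
  have h2 : exc z (2 * m + 2 + 2) ≤ exc z (m + 2) ^ 2 := by
    have := exc_two_mul_le_sq h m
    rwa [show 2 * (m + 2) = 2 * m + 2 + 2 from by ring] at this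
  have h0 := exc_nonneg h m
  rw [show 3 * m + 4 + 2 = m + 2 + (2 * m + 2 + 2) from by ring]
  calc exc z (m + 2 + (2 * m + 2 + 2)) ≤ exc z (m + 2) * exc z (2 * m + 2 + 2) := h1
    _ ≤ exc z (m + 2) * exc z (m + 2) ^ 2 := mul_le_mul_of_nonneg_left h2 h0
    _ = exc z (m + 2) ^ 3 := by ring

/-- `2 x_{m+2} ≤ δ (1 + x_{m+2})²` for the purity defect `δ = 1 − z(2(m+2))/z(m+2)²`. -/
theorem two_exc_le (h : HasSpectralDatum z) (m : ℕ) {η : ℝ} (hδ : 1 - z (2 * (m + 2)) / z (m + 2) ^ 2 ≤ η) :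
    2 * exc z (m + 2) ≤ η * (1 + exc z (m + 2)) ^ 2 := by
  have hx1 := exc_nonneg h m
  have e1 := z_eq_exp_mul z m
  have e2 : z (2 * (m + 2)) = Real.exp (((2 * (m + 2) : ℕ) : ℝ) * phi z) * (1 + exc z (2 * (m + 2))) := by
    have := z_eq_exp_mul z (2 * m + 2)
    rwa [show 2 * m + 2 + 2 = 2 * (m + 2) from by ring] at this
  have e3 : Real.exp (((2 * (m + 2) : ℕ) : ℝ) * phi z) = Real.exp (((m + 2 : ℕ) : ℝ) * phi z) ^ 2 := by
    rw [← Real.exp_nat_mul]; push_cast; ring_nf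
  have hE : 0 < Real.exp (((m + 2 : ℕ) : ℝ) * phi z) := Real.exp_pos _
  have hx2sq : exc z (2 * (m + 2)) ≤ exc z (m + 2) ^ 2 := exc_two_mul_le_sq h m
  set x : ℝ := exc z (m + 2) with hxdef
  set x2 : ℝ := exc z (2 * (m + 2)) with hx2def
  have hx0 : (1 + x) ≠ 0 := ne_of_gt (by linarith)
  have hratio : z (2 * (m + 2)) / z (m + 2) ^ 2 = (1 + x2) / (1 + x) ^ 2 := by
    rw [e2, e3, e1]
    field_simp
  rw [hratio] at hδ
  have hpos : 0 < (1 + x) ^ 2 := by positivity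
  have h1 : (1 + x) ^ 2 - (1 + x2) ≤ η * (1 + x) ^ 2 := by
    have := hδ
    rw [sub_le_iff_le_add, ← sub_le_iff_le_add', le_div_iff₀ hpos] at this
    linarith
  nlinarith

/-- Refined purity bound: `x_{m+2} ≤ δ (1 + δ(1+2δ)²/2)² / 2` for `δ ≤ 1/2`. -/
theorem exc_le_refined (h : HasSpectralDatum z) (m : ℕ) {η : ℝ} (hη : η ≤ 1 / 2)
    (hδ : 1 - z (2 * (m + 2)) / z (m + 2) ^ 2 ≤ η) :
    exc z (m + 2) ≤ η * (1 + η * (1 + 2 * η) ^ 2 / 2) ^ 2 / 2 := by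
  have hη0 : 0 ≤ η := (defect_facts h m).1.trans hδ
  have hx0 := exc_nonneg h m
  have hbar := exc_le_sharp h m hη hδ
  have h2 := two_exc_le h m hδ
  have h3 : (1 + exc z (m + 2)) ^ 2 ≤ (1 + η * (1 + 2 * η) ^ 2 / 2) ^ 2 :=
    pow_le_pow_left₀ (by linarith) (by linarith) 2
  have h4 := mul_le_mul_of_nonneg_left h3 hη0
  linarith

end OneBox

/-! ## §2 The quadrupling step below `1/24` -/

section Rung24
variable {Z : ℕ → ℕ → ℕ → ℕ → ℝ}
set_option maxHeartbeats 400000 in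
/-- **One exact quadrupling below `1/24`** (no volume bounds): `boxDefect Z L ≤ u ≤ 1/24 ⇒ boxDefect Z (4L) ≤ 10600 u⁴`. -/
theorem basin_step24 (hS : IsAxisSymmetric Z) (hT : IsTracePositive Z)
    (L : ℕ) (hL : 8 ≤ L) {u : ℝ} (hu : boxDefect Z L ≤ u) (hu24 : u ≤ 1 / 24) :
    boxDefect Z (4 * L) ≤ 10600 * u ^ 4 := by
  set L' := 4 * L with hL'def
  obtain ⟨k, hk⟩ : ∃ k, L / 4 = k + 2 := ⟨L / 4 - 2, by omega⟩
  obtain ⟨k', hk'⟩ : ∃ k', L' / 4 = k' + 2 := ⟨L' / 4 - 2, by omega⟩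
  have h4k : 4 * (k + 2) ≤ L := by omega
  have hkk' : 4 * k + 6 ≤ k' := by omega
  have hLL' : L ≤ L' := by omega
  have hL2 : 2 ≤ L := by omega
  have hL'2 : 2 ≤ L' := by omega
  have hz : HasSpectralDatum (Z L L L) := hT L L L hL2 hL2 hL2
  have hz' : HasSpectralDatum (Z L' L' L') := hT L' L' L' hL'2 hL'2 hL'2
  have hδL0 : 0 ≤ boxDefect Z L := boxDefect_nonneg_of_le hT L hL
  simp only [boxDefect, hk] at hu hδL0
  simp only [boxDefect, hk']
  obtain ⟨-, -, hδ'x, -⟩ := defect_facts hz' k'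
  set δ : ℝ := 1 - Z L L L (2 * (k + 2)) / Z L L L (k + 2) ^ 2 with hδdef
  set δ' : ℝ := 1 - Z L' L' L' (2 * (k' + 2)) / Z L' L' L' (k' + 2) ^ 2 with hδ'def
  have hu0 : 0 ≤ u := hδL0.trans hu
  have hhalf : δ ≤ 1 / 2 := hu.trans (hu24.trans (by norm_num))
  -- (1) refined purity of the small cube: x_t ≤ 0.5248 u
  have hxr := exc_le_refined hz k hhalf le_rfl
  have hx0 : 0 ≤ exc (Z L L L) (k + 2) := exc_nonneg hz k
  have h12 : (1 + 2 * δ) ^ 2 ≤ (13 / 12 : ℝ) ^ 2 :=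
    pow_le_pow_left₀ (by linarith) (by linarith) 2
  have hbar : δ * (1 + 2 * δ) ^ 2 / 2 ≤ 0.02446 := by
    have h1 : δ * (1 + 2 * δ) ^ 2 ≤ (1 / 24) * (13 / 12 : ℝ) ^ 2 :=
      mul_le_mul (by linarith) h12 (by positivity) (by norm_num)
    have : (1 / 24) * (13 / 12 : ℝ) ^ 2 / 2 ≤ 0.02446 := by norm_num
    linarith
  have hbar0 : 0 ≤ δ * (1 + 2 * δ) ^ 2 / 2 := by positivity
  have hsq : (1 + δ * (1 + 2 * δ) ^ 2 / 2) ^ 2 ≤ 1.0496 := by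
    have h1 : (1 + δ * (1 + 2 * δ) ^ 2 / 2) ^ 2 ≤ (1 + 0.02446 : ℝ) ^ 2 :=
      pow_le_pow_left₀ (by linarith) (by linarith) 2
    have : (1 + 0.02446 : ℝ) ^ 2 ≤ 1.0496 := by norm_num
    linarith
  have hP : exc (Z L L L) (k + 2) ≤ 0.5248 * u := by
    have h1 : δ * (1 + δ * (1 + 2 * δ) ^ 2 / 2) ^ 2 ≤ u * 1.0496 :=
      mul_le_mul hu hsq (by positivity) hu0
    linarith
  -- (2) forward in time on the small cube: x_{3t} ≤ x_t³ ≤ (0.5248 u)³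
  have hx3 : exc (Z L L L) (3 * k + 4 + 2) ≤ (0.5248 * u) ^ 3 :=
    (exc_three_mul_le_cube hz k).trans (pow_le_pow_left₀ hx0 hP 3)
  have hY3 : Yfun (Z L L L) (3 * k + 4 + 2) ≤ (0.5248 * u) ^ 3 := (Yfun_le_exc hz (3 * k + 4)).trans hx3
  have hY30 : 0 ≤ Yfun (Z L L L) (3 * k + 4 + 2) := Yfun_nonneg hz (3 * k + 4)
  -- (3) sharp cube extension at time c = 3t: ratio 4L/(L − 3t) ≤ 16, factor 4096
  have hcL : 3 * k + 4 + 2 < L := by omega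
  have e := cube_extension_sharp hS hT (c := 3 * k + 4 + 2) (L := L) (L' := L') (by omega) hcL hLL'
  have hLr : (0 : ℝ) < (L : ℝ) - ((3 * k + 4 + 2 : ℕ) : ℝ) := by
    have : ((3 * k + 4 + 2 : ℕ) : ℝ) < (L : ℝ) := by exact_mod_cast hcL
    linarith
  have hq : (L' : ℝ) / ((L : ℝ) - ((3 * k + 4 + 2 : ℕ) : ℝ)) ≤ 16 := by
    rw [div_le_iff₀ hLr, hL'def]
    have h4k' : (4 : ℝ) * ((k + 2 : ℕ) : ℝ) ≤ (L : ℝ) := by exact_mod_cast h4k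
    push_cast at h4k' ⊢
    linarith
  have hq0 : 0 ≤ (L' : ℝ) / ((L : ℝ) - ((3 * k + 4 + 2 : ℕ) : ℝ)) := div_nonneg (by positivity) hLr.le
  have hq3 : ((L' : ℝ) / ((L : ℝ) - ((3 * k + 4 + 2 : ℕ) : ℝ))) ^ 3 ≤ 4096 := by
    calc ((L' : ℝ) / ((L : ℝ) - ((3 * k + 4 + 2 : ℕ) : ℝ))) ^ 3 ≤ (16 : ℝ) ^ 3 := pow_le_pow_left₀ hq0 hq 3
      _ = 4096 := by norm_num
  have hu3 : u ^ 3 ≤ (1 / 24 : ℝ) ^ 3 := pow_le_pow_left₀ hu0 hu24 3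
  have hB : Yfun (Z L' L' L') (3 * k + 4 + 2) ≤ 592.1 * u ^ 3 := by
    have e' : Yfun (Z L' L' L') (3 * k + 4 + 2) ≤
        ((L' : ℝ) / ((L : ℝ) - ((3 * k + 4 + 2 : ℕ) : ℝ))) ^ 3 * Yfun (Z L L L) (3 * k + 4 + 2) := by
      simpa using e
    have e'' : Yfun (Z L' L' L') (3 * k + 4 + 2) ≤ 4096 * Yfun (Z L L L) (3 * k + 4 + 2) :=
      e'.trans (mul_le_mul_of_nonneg_right hq3 hY30)
    have h1 : 4096 * Yfun (Z L L L) (3 * k + 4 + 2) ≤ 4096 * (0.5248 * u) ^ 3 :=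
      mul_le_mul_of_nonneg_left hY3 (by norm_num)
    have h2 : 4096 * (0.5248 * u) ^ 3 = (4096 * 0.5248 ^ 3) * u ^ 3 := by ring
    have h3 : (4096 * 0.5248 ^ 3 : ℝ) * u ^ 3 ≤ 592.1 * u ^ 3 :=
      mul_le_mul_of_nonneg_right (by norm_num) (by positivity)
    linarith
  have hB0 : 0 ≤ Yfun (Z L' L' L') (3 * k + 4 + 2) := Yfun_nonneg hz' (3 * k + 4)
  have hBsmall : Yfun (Z L' L' L') (3 * k + 4 + 2) ≤ 0.0429 := by
    have : 592.1 * u ^ 3 ≤ 592.1 * (1 / 24 : ℝ) ^ 3 := mul_le_mul_of_nonneg_left hu3 (by norm_num)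
    have h' : 592.1 * (1 / 24 : ℝ) ^ 3 ≤ 0.0429 := by norm_num
    linarith
  -- (4) excess of the big cube at time 3t: x' = e^{Y'} − 1 ≤ Y' + Y'² ≤ 617.6 u³
  have hx3' : exc (Z L' L' L') (3 * k + 4 + 2) ≤ 617.6 * u ^ 3 := by
    rw [exc_eq_exp_Yfun hz' (3 * k + 4)]
    set Y := Yfun (Z L' L' L') (3 * k + 4 + 2) with hYdef
    have hYle1 : |Y| ≤ 1 := by rw [abs_of_nonneg hB0]; linarith
    have hexp : Real.exp Y - 1 ≤ Y + Y ^ 2 := by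
      have := (abs_le.1 (Real.abs_exp_sub_one_sub_id_le hYle1)).2
      linarith
    have hY2 : Y ^ 2 ≤ Y * 0.0429 := by rw [sq]; exact mul_le_mul_of_nonneg_left hBsmall hB0
    have h1 : Y + Y ^ 2 ≤ 1.0429 * Y := by linarith
    have h2 : 1.0429 * Y ≤ 1.0429 * (592.1 * u ^ 3) := mul_le_mul_of_nonneg_left hB (by norm_num)
    have h3 : 1.0429 * (592.1 * u ^ 3) ≤ 617.6 * u ^ 3 := by
      have : (1.0429 * 592.1 : ℝ) ≤ 617.6 := by norm_num
      nlinarith [pow_nonneg hu0 3]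
    linarith
  -- (5) forward 3t → 4t on the big cube by the root bound with c = 8.53 u (c³ = 620.65 u³ ≥ 617.6 u³ ≥ x'_{3t})
  have hc0 : 0 ≤ 8.53 * u := by positivity
  have hc3 : exc (Z L' L' L') (3 * k + 4 + 2) ≤ (8.53 * u) ^ (2 + 1) := by
    have : (617.6 : ℝ) * u ^ 3 ≤ (8.53 * u) ^ (2 + 1) := by
      rw [show (8.53 * u) ^ (2 + 1) = 8.53 ^ 3 * u ^ 3 from by ring]
      exact mul_le_mul_of_nonneg_right (by norm_num) (by positivity)
    exact hx3'.trans this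
  have hx4' : exc (Z L' L' L') (k + 2 + (3 * k + 4 + 2)) ≤ 8.53 * u * exc (Z L' L' L') (3 * k + 4 + 2) :=
    exc_add_le_of_pow_le hz' k (3 * k + 4) 2 (3 * k + 4) (by ring) hc0 hc3
  have hx4'' : exc (Z L' L' L') (4 * k + 6 + 2) ≤ 5269 * u ^ 4 := by
    rw [show 4 * k + 6 + 2 = k + 2 + (3 * k + 4 + 2) from by ring]
    have h1 : 8.53 * u * exc (Z L' L' L') (3 * k + 4 + 2) ≤ 8.53 * u * (617.6 * u ^ 3) :=
      mul_le_mul_of_nonneg_left hx3' hc0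
    have h2 : 8.53 * u * (617.6 * u ^ 3) = (8.53 * 617.6) * u ^ 4 := by ring
    have h3 : (8.53 * 617.6 : ℝ) * u ^ 4 ≤ 5269 * u ^ 4 := mul_le_mul_of_nonneg_right (by norm_num) (by positivity)
    linarith
  -- (6) down to the big cube's own quarter-time k'+2 ≥ 4t and to its defect
  have hx'k' : exc (Z L' L' L') (k' + 2) ≤ exc (Z L' L' L') (4 * k + 6 + 2) := exc_antitone hz' hkk'
  have hu4 : 0 ≤ u ^ 4 := by positivity
  calc δ' ≤ 2 * exc (Z L' L' L') (k' + 2) := hδ'x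
    _ ≤ 2 * (5269 * u ^ 4) := by linarith
    _ ≤ 10600 * u ^ 4 := by linarith

end Rung24

/-- **PROVED RUNG 1/24**: `AbstractBasin (1/24) (1/2^6)` — two exact quadruplings (`10600/24⁴ ≤ 0.032`, `10600·0.032⁴ ≤ 2⁻⁶`). -/
theorem abstractBasin_24 : AbstractBasin (1 / 24) (1 / 2 ^ 6) := by
  intro Z hS hT _hV L hL hδ
  have h1 := basin_step24 hS hT L hL hδ le_rfl
  have h1' : boxDefect Z (4 * L) ≤ 0.032 := h1.trans (by norm_num)
  have h2 := basin_step24 hS hT (4 * L) (by omega) h1' (by norm_num)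
  exact ⟨4 * (4 * L), by omega, h2.trans (by norm_num)⟩

/-- `AbstractBasin (1/24) epsStar`: compose with the landed rungs `2⁻⁶ → 2⁻⁸ → 2⁻⁹ → 2⁻²⁴`. -/
theorem abstractBasin_24_epsStar : AbstractBasin (1 / 24) epsStar :=
  abstractBasin_trans abstractBasin_24 abstractBasin_two_pow_6_epsStar

/-- **The bill with the seed at ONE tolerance `1/24` at ONE scale**: `ColdExitAt (1/24) → AFToColdPressure → IRnsc → IR`. -/
theorem IR_of_exitAt24 (hE : ColdExitAt (1 / 24)) (hX : AFToColdPressure) (hN : IRnsc) :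
    Summit.QuantumFields.YangMills.Theses.BalabanLadder.IR :=
  IR_of_exitAt6 (coldExitAt_of_abstractBasin hE abstractBasin_24) hX hN

/-- Monotone packaging: any tolerance `θ ≤ 1/24` at one scale suffices. -/
theorem IR_of_exitAt_le24 {θ : ℝ} (hθ : θ ≤ 1 / 24) (hE : ColdExitAt θ) (hX : AFToColdPressure) (hN : IRnsc) :
    Summit.QuantumFields.YangMills.Theses.BalabanLadder.IR :=
  IR_of_exitAt24 (coldExitAt_mono hθ hE) hX hN

end Summit.QuantumFields.YangMills.Cruxes.IR.BasinRung

end
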